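import Literature.AlgebraicGeometry.ModuliOfAbelianVarieties.SiegelAdelicCongrTransport      -- ★ `coe_mem_units_matrix_integralFiniteAdeles_of_mem_principalLevelSubgroup_one` (+ ★ `SiegelModuliInterpretation`: `SiegelAdelicMarking`, `isLatticeBasis_iff_latticeOfGL_eq`, `IsLatticeBasis.mul_of_mem_principalLevelSubgroup_one`)
import HarnessLib

/-!
# Re-basing an adelic marking along equal lattices; lattice labels of principal-level representatives

Topic `AlgebraicGeometry/ModuliOfAbelianVarieties`; namespace `Literature.AlgebraicGeometry.ModuliOfAbelianVarieties`.  THEOREMS ONLY (no definition, no named fact,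
no instance, no notation, no `sorry`).  Cell `hodgecm-mathlib`, FLOOR 0, P6 «MOD programme» (crux hLiu418 = stmt-HodgeConjecture-24832, `--supports`, count-neutral); line L4,
(S8) sheet-line closer, road B′, DEAL #32′ junction glue «σ1-UNPACK» (LA4-p05 (g4) 08:4xZ re-cut; LA5-p02 (g4) 08:35:15Z «change the INPUT marking՚s label by same-lattice»).

SETTING ([Milne2005ShimuraVarieties] §4 pp. 48–49 «`Λ_{au} = Λ_a` for `u ∈ GL_n(ẑ)`», §6 Thm. 6.11 p. 74 and p. 75; [Deligne1971TravauxShimura] 4.11–4.12, Exemple 4.16).  A ★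
`SiegelAdelicMarking J a A` of a complex abelian variety depends on the adelic point `a` ONLY through the lattice `Λ_a = ℚ^{2g} ∩ aẑ^{2g}` (its field `γ_isLatticeBasis :
IsLatticeBasis a γ`, i.e. `Λ_a = γℤ^{2g}`, ★ `isLatticeBasis_iff_latticeOfGL_eq`).  So (§2) a marking by `[J, a]` IS — same basis matrix `γ`, complex coordinates `Ψ`,
uniformisation `toFun`, torsion parametrisation `r` — a marking by `[J, a′]` whenever `Λ_{a′} = Λ_a`, in particular for `a′ = a·k`, `k ∈ GSp_δ(ẑ) = K_δ(1)`, and for any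
two elements of `K_δ(1)` (both lattices are `ℤ^{2g}`).  §1 supplies the lattice labels: `Λ_s = Λ_{s′}` for `s, s′ ∈ K_δ(1)`, and
`K_δ(1)`-membership transported along a class equality `[s] = [s′]` in `GSp_δ(𝔸_f) ⧸ K_δ(N)`.  USE (P6 σ1-UNPACK): the σ1 organ `Reads` marks a chart fibre by
`[J(Z a v), r]` with `r ∈ K_δ(1)` a principal representative; the chart mover law `(q a)_𝔸 · rep (piece a) ≡ b(a) mod K_δ(N)` (`AuxChartGS.q_spec`) puts
`r′ := (q a)⁻¹_𝔸 · b(a)` in `rep (piece a) · K_δ(N) ⊆ K_δ(1)`; §2 moves the σ1 marking onto `r′`, where the moved torus-leg identities of ★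
`UnitaryCurveAuxiliaryTorusLegLattice` §9 (`r′ = γ·ũ_β(p)`, `γ := (q a)⁻¹`, `p := (a,1)`) apply.

* §1 `latticeOfGL_coe_eq_of_mem_principalLevelSubgroup_one`, `mem_principalLevelSubgroup_one_of_mk_eq` (the single-representative label `Λ_k = Λ_1` is ★
  `latticeOfGL_coe_eq_one_of_mem_principalLevelSubgroup_one` ∕ ★ `isLatticeBasis_one_of_mem_principalLevelSubgroup_one`, not restated).
* §2 **`SiegelAdelicMarking.exists_eq_of_latticeOfGL_eq`**, `SiegelAdelicMarking.exists_eq_mul_of_mem_principalLevelSubgroup_one`,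
  `SiegelAdelicMarking.exists_eq_of_mem_principalLevelSubgroup_one`.
Budgets: default heartbeats.

References: [Milne2005ShimuraVarieties] J. S. Milne, *Introduction to Shimura varieties* (2005), §4 pp. 48–49, §6 Thm. 6.11 p. 74 and p. 75; [Deligne1971TravauxShimura]
P. Deligne, *Travaux de Shimura* (1971), 4.11–4.12 pp. 148–149 and Exemple 4.16 p. 150.
HC_CM is proved only modulo the printed citations (2 remaining named inputs hLiu418 24832, h413 24833) until rung 0 closes — count-neutral.
-/

set_option autoImplicit false

noncomputable section

open Matrix NumberField IsDedekindDomain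
open Literature.NumberTheory.Adeles (latticeOfGL latticeOfGL_mul_eq_of_mem)

namespace Literature.AlgebraicGeometry.ModuliOfAbelianVarieties

open Literature.AlgebraicGeometry.Motives (AbelianVariety)

variable {g : ℕ} {δ : Fin g → ℕ}

/-! ### §1 Lattice labels of principal-level representatives -/

/-- **`Λ_s = Λ_{s′}` for `s, s′ ∈ K_δ(1)`** (both are `ℤ^{2g}`). [cite: Milne2005ShimuraVarieties, §4 pp. 48–49] -/
theorem latticeOfGL_coe_eq_of_mem_principalLevelSubgroup_one {s s' : ↥(gspFinAdelic δ)} (hs : s ∈ principalLevelSubgroup δ 1)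
    (hs' : s' ∈ principalLevelSubgroup δ 1) :
    latticeOfGL (s : GL (Fin g ⊕ Fin g) finAdeleQ) = latticeOfGL (s' : GL (Fin g ⊕ Fin g) finAdeleQ) := by
  -- both are `Λ_1` (★ `latticeOfGL_mul_eq_of_mem` at `a := 1`; cf. ★ `latticeOfGL_coe_eq_one_of_mem_principalLevelSubgroup_one`)
  rw [← one_mul (s : GL (Fin g ⊕ Fin g) finAdeleQ), ← one_mul (s' : GL (Fin g ⊕ Fin g) finAdeleQ),
    latticeOfGL_mul_eq_of_mem 1 (coe_mem_units_matrix_integralFiniteAdeles_of_mem_principalLevelSubgroup_one hs),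
    latticeOfGL_mul_eq_of_mem 1 (coe_mem_units_matrix_integralFiniteAdeles_of_mem_principalLevelSubgroup_one hs')]

/-- **`K_δ(1)`-membership along a class equality mod `K_δ(N)`**: if `[s] = [s′]` in `GSp_δ(𝔸_f) ⧸ K_δ(N)` and `s′ ∈ K_δ(1)` then `s ∈ K_δ(1)` (`K_δ(N) ≤ K_δ(1)`).  USE:
the chart mover law `(q a)_𝔸 · rep (piece a) ≡ b(a) mod K_δ(N)` puts `(q a)⁻¹_𝔸 · b(a)` in `K_δ(1)` with the principal representative `rep (piece a)`.
[cite: Deligne1971TravauxShimura, Exemple 4.16 p. 150] [cite: Milne2005ShimuraVarieties, §6 p. 70] -/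
theorem mem_principalLevelSubgroup_one_of_mk_eq {N : ℕ} {s s' : ↥(gspFinAdelic δ)}
    (h : (s : ↥(gspFinAdelic δ) ⧸ principalLevelSubgroup δ N) = (s' : ↥(gspFinAdelic δ) ⧸ principalLevelSubgroup δ N))
    (hs' : s' ∈ principalLevelSubgroup δ 1) : s ∈ principalLevelSubgroup δ 1 := by
  have hq : s⁻¹ * s' ∈ principalLevelSubgroup δ 1 := principalLevelSubgroup_anti δ (one_dvd N) (QuotientGroup.eq.1 h)
  have hs : s = s' * (s⁻¹ * s')⁻¹ := by group
  rw [hs]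
  exact mul_mem hs' (inv_mem hq)

/-! ### §2 Re-basing a marking along equal lattices -/

variable {J : C0pm δ} {a : ↥(gspFinAdelic δ)} {A : AbelianVariety ℂ}

/-- **A marking by `[J, a]` IS a marking by `[J, a′]` whenever `Λ_{a′} = Λ_a`** — same basis matrix `γ`, complex coordinates `Ψ`, uniformisation `toFun` and torsion
parametrisation `r` (the marking depends on `a` only through the lattice `Λ_a = γℤ^{2g}`, ★ `isLatticeBasis_iff_latticeOfGL_eq`).
[cite: Milne2005ShimuraVarieties, §6 Thm. 6.11 p. 74 and p. 75] [cite: Deligne1971TravauxShimura, 4.11–4.12 pp. 148–149] -/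
theorem SiegelAdelicMarking.exists_eq_of_latticeOfGL_eq (m : SiegelAdelicMarking J a A) {a' : ↥(gspFinAdelic δ)}
    (h : latticeOfGL (a' : GL (Fin g ⊕ Fin g) finAdeleQ) = latticeOfGL (a : GL (Fin g ⊕ Fin g) finAdeleQ)) :
    ∃ m' : SiegelAdelicMarking J a' A, m'.γ = m.γ ∧ m'.Ψ = m.Ψ ∧ m'.toFun = m.toFun ∧ ∀ v, m'.r v = m.r v := by
  have hb : IsLatticeBasis a' m.γ := by
    rw [isLatticeBasis_iff_latticeOfGL_eq, h, ← isLatticeBasis_iff_latticeOfGL_eq]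
    exact m.γ_isLatticeBasis
  exact ⟨⟨m.γ, hb, m.Ψ, m.Ψ_J, m.toFun, m.isAnalytification, m.toFun_add⟩, rfl, rfl, rfl, fun _ => rfl⟩

/-- **A marking by `[J, a]` IS a marking by `[J, a·k]` for `k ∈ K_δ(1) = GSp_δ(ẑ)`** (`Λ_{ak} = Λ_a`, ★ `IsLatticeBasis.mul_of_mem_principalLevelSubgroup_one`) — same
`γ, Ψ, toFun, r`. [cite: Milne2005ShimuraVarieties, §4 pp. 48–49 and §6 Thm. 6.11 p. 74] -/
theorem SiegelAdelicMarking.exists_eq_mul_of_mem_principalLevelSubgroup_one (m : SiegelAdelicMarking J a A) {k : ↥(gspFinAdelic δ)}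
    (hk : k ∈ principalLevelSubgroup δ 1) :
    ∃ m' : SiegelAdelicMarking J (a * k) A, m'.γ = m.γ ∧ m'.Ψ = m.Ψ ∧ m'.toFun = m.toFun ∧ ∀ v, m'.r v = m.r v :=
  ⟨⟨m.γ, m.γ_isLatticeBasis.mul_of_mem_principalLevelSubgroup_one hk, m.Ψ, m.Ψ_J, m.toFun, m.isAnalytification, m.toFun_add⟩,
    rfl, rfl, rfl, fun _ => rfl⟩

/-- **Two principal-level representatives carry the same markings**: a marking by `[J, a]` with `a ∈ K_δ(1)` IS a marking by `[J, a′]` for every `a′ ∈ K_δ(1)` — same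
`γ, Ψ, toFun, r`.  USE (σ1-UNPACK): move the σ1 marking from the principal representative `r` onto `r′ := (q a)⁻¹_𝔸 · b(a) ∈ rep (piece a) · K_δ(N)`.
[cite: Milne2005ShimuraVarieties, §4 pp. 48–49 and §6 Thm. 6.11 p. 74] [cite: Deligne1971TravauxShimura, Exemple 4.16 p. 150] -/
theorem SiegelAdelicMarking.exists_eq_of_mem_principalLevelSubgroup_one (m : SiegelAdelicMarking J a A) (ha : a ∈ principalLevelSubgroup δ 1)
    {a' : ↥(gspFinAdelic δ)} (ha' : a' ∈ principalLevelSubgroup δ 1) :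
    ∃ m' : SiegelAdelicMarking J a' A, m'.γ = m.γ ∧ m'.Ψ = m.Ψ ∧ m'.toFun = m.toFun ∧ ∀ v, m'.r v = m.r v :=
  m.exists_eq_of_latticeOfGL_eq (latticeOfGL_coe_eq_of_mem_principalLevelSubgroup_one ha' ha)

end Literature.AlgebraicGeometry.ModuliOfAbelianVarieties

end
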